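import Summits.QuantumFields.BalabanUV.T4Continuum.Support.NE3LadderCovariantDifference
import HarnessLib

/-!
# NE7LadderCovariantShift — THE COVARIANT SHIFT OF A LADDER HOLONOMY IN AN ARBITRARY DIRECTION `τ`, AND THE INSERTION OF ONE LETTER INTO THE LADDER WORD:
# `‖Ad_{V(p−e_τ,τ)}V(p; ladder_Q μ) − V(p−e_τ; ladder_Q μ)‖ ≤ |Q|·x₁ + 2|Q|²·x²` (`τ ∉ Q`, `τ ≠ μ` or `τ = μ`), `‖V(p; ladder_{A++X} μ) − V(p; ladder_{A++Y} μ)‖ =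
# ‖V(p+|A|; ladder_X μ) − V(p+|A|; ladder_Y μ)‖`, `‖V(q; ladder_{(τ⁺)::B} μ) − V(q; ladder_B μ)‖ ≤ |B|·x₁ + 2|B|²x² + x`

Cell `pub-balaban`, rung (B)+1 sub-cell t4, lineage `b2b-balaban-t4-ne7-p1` (CRUX PROVER NE7 #1 = OWNER of row NE7), generation 91; memo
`t4/b2b-balaban-t4-ne7-p1-g91/COVER-OBSTRUCTION.md` §3 (the chart from plaquette data).  Over `NE3LadderCovariantDifference` (census R39 of
`pub-balaban-gaps`, the case `τ = μ`).

WHY.  THE CHART of row NE7 ([B8] Thm 2 at `U₀ = 1` TYPE: a local gauge with `M·|A| ≲ t`, `M²·|∇A| ≲ t`, ALL lattice directions of `∇`) is to be read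
off the AXIAL gauge of [Balaban1985Averaging] pp. 24–25 from two gauge-invariant data of the configuration: the plaquette radius `x` (`≍ t∕M²`) and the
covariant plaquette-GRADIENT radius `x₁` (`≍ t∕M³`, [Balaban1985Variational] Thm 1 (9)–(10) TYPE regularity of the minimiser).  In the axial gauge a
`μ`-bond variable is a ladder holonomy `V₀(w; ladder_Q μ)` (`B8Lemma1NonAbelian.axial_bond_eq_sharp`); its difference in the direction `μ` is the census-R39
lemma; its difference in a direction `τ < μ` is the INSERTION of one letter `(τ, +)` into `Q` at the same base point (§3), which costs one plaquette plus the
covariant `τ`-shift of the tail ladder (§1); the directions `τ > μ` follow from `τ < μ` by the plaquette identity (successor file).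
WHAT ([folklore] lattice gauge kinematics; 0 def, 0 sorry):
§1 **`ladder_covShift_le`** — `NE3LadderCovariantDifference.ladder_covDiff_le` with the shift direction `μ` replaced by an arbitrary `τ` avoided by `Q`
   (same induction over `hol_ladder_cons`; the transport plaquette is now `(τ, κ)` at `p − e_τ`).
§2 **`norm_ladder_append_sub_eq`** — a common forward prefix `A` (avoiding `μ`) conjugates both ladders by the same unitary and multiplies by the same
   plaquettes: the norm of the difference is that of the tails at `p + disp A`.
§3 **`norm_ladder_cons_sub_le`** — inserting one forward letter `(τ, +)` (`τ ≠ μ`, `τ ∉ B`) in front of `B`: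
   `‖V(q; ladder_{(τ,+)::B} μ) − V(q; ladder_B μ)‖ ≤ |B|·x₁ + 2|B|²·x² + x`; **`norm_ladder_insert_sub_le`** — the same behind a common prefix `A`.

HONEST FRAMING (page 1): kinematics of an arbitrary unitary lattice configuration; nothing of Bałaban's asserted; THE CHART, (APE) and NE7 NOT proved here;
spine 0∕9; finite T⁴ rung (B)+1 — NOT infinite volume, NOT mass gap, NOT `BetaPertH`, NOT Clay.  Continuum YM on T⁴ ⇐ BetaPertH ∧ nine spine estimates (0/9
proved); BetaPertH ⇐ (D1) ∧ (D4) ∧ CAP+tail; G-an2-4 gates asym, D1 and NE2/3/4.  No `sorry`; axioms ⊆ {propext, Classical.choice, Quot.sound}.  PLACEMENT: our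
lemma, under `Summits/QuantumFields/BalabanUV/`.
-/

set_option autoImplicit false

open scoped BigOperators Matrix Matrix.Norms.L2Operator
open NormedSpace Finset

namespace Summit.QuantumFields.BalabanUV.T4Continuum.NE7LadderCovariantShift

open Literature.MathematicalPhysics.QuantumFieldTheory.Balaban1983to89
open B7Prop1Explicit B7Prop2Explicit
open B7Prop1Local (hol_plaqWord_eq)
open T4AveragingDeficitWall (Ad IsUnitaryCfg SmallField)
open T4AveragingDeficitNonAbelian (Ad_mul Ad_sub)
open AveragingDeficitNearIdentity (norm_Ad_sub_le Ad_one)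
open AveragingDeficitTransport (norm_Ad_of_unitary mem_U1_of_unitary)
open NE3LadderCovariantDifference (norm_coe_eq_one norm_Ad_sub_le_of_sub_one)

noncomputable section

variable {d : ℕ} {n : Type*} [Fintype n] [DecidableEq n]

/-! ## §1 The covariant `τ`-shift of a ladder holonomy -/

/-- **THE LADDER HOLONOMY IS NEAR `1` AND ITS COVARIANT `τ`-SHIFT IS A SUM OF PLAQUETTE GRADIENTS** (any unitary `V` with `SmallField V x` and covariant
plaquette `τ`-gradients of the `(κ, μ)`-plaquettes `≤ x₁`; `Q` a forward word avoiding `μ` and `τ`; `τ = μ` allowed — then this is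
`NE3LadderCovariantDifference.ladder_covDiff_le`): `‖V(p; ladder_Q μ) − 1‖ ≤ |Q|·x` and
`‖Ad_{V(p−e_τ,τ)}V(p; ladder_Q μ) − V(p−e_τ; ladder_Q μ)‖ ≤ |Q|·x₁ + 2|Q|²·x²`. [folklore] -/
theorem ladder_covShift_le [Nonempty n] {V : Site d → Fin d → (Matrix n n ℂ)ˣ} (hV : IsUnitaryCfg V) (μ τ : Fin d) {x x₁ : ℝ} (hx0 : 0 ≤ x)
    (hplaq : SmallField V x)
    (hgrad : ∀ (p : Site d) (κ : Fin d), κ ≠ μ →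
      ‖Ad (V p τ) ((hol V (p + e τ) (plaqWord κ μ) : (Matrix n n ℂ)ˣ) : Matrix n n ℂ) - ((hol V p (plaqWord κ μ) : (Matrix n n ℂ)ˣ) : Matrix n n ℂ)‖ ≤ x₁) :
    ∀ (Q : List (Letter d)), (∀ l ∈ Q, l.2 = true ∧ l.1 ≠ μ ∧ l.1 ≠ τ) → ∀ p : Site d,
      ‖((hol V p (ladder Q μ) : (Matrix n n ℂ)ˣ) : Matrix n n ℂ) - 1‖ ≤ Q.length * x ∧
      ‖Ad (V (p - e τ) τ) ((hol V p (ladder Q μ) : (Matrix n n ℂ)ˣ) : Matrix n n ℂ) - ((hol V (p - e τ) (ladder Q μ) : (Matrix n n ℂ)ˣ) : Matrix n n ℂ)‖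
        ≤ Q.length * x₁ + 2 * (Q.length : ℝ) ^ 2 * x ^ 2
  | [], _, p => by
      have h1 : ((hol V p (ladder [] μ) : (Matrix n n ℂ)ˣ) : Matrix n n ℂ) = 1 := by simp [ladder, revWord, stepHol_true, stepHol_false]
      have h2 : ((hol V (p - e τ) (ladder [] μ) : (Matrix n n ℂ)ˣ) : Matrix n n ℂ) = 1 := by simp [ladder, revWord, stepHol_true, stepHol_false]
      rw [h1, h2]
      constructor
      · simp
      · unfold Ad; rw [mul_one, Units.mul_inv]; simp
  | l :: Q, hQ, p => by
      obtain ⟨κ, b⟩ := l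
      obtain ⟨hb, hκμ, hκτ⟩ := hQ (κ, b) (by simp)
      simp only at hb hκμ hκτ
      subst hb
      have hQ' : ∀ l ∈ Q, l.2 = true ∧ l.1 ≠ μ ∧ l.1 ≠ τ := fun l hl => hQ l (List.mem_cons_of_mem _ hl)
      have hx10 : 0 ≤ x₁ := (norm_nonneg _).trans (hgrad p κ hκμ)
      -- names
      set S : (Matrix n n ℂ)ˣ := V p κ with hS
      set St : (Matrix n n ℂ)ˣ := V (p - e τ) κ with hSt
      set U : (Matrix n n ℂ)ˣ := V (p - e τ) τ with hU
      set U' : (Matrix n n ℂ)ˣ := V (p + e κ - e τ) τ with hU'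
      set P : (Matrix n n ℂ)ˣ := hol V p (plaqWord κ μ) with hP
      set Pt : (Matrix n n ℂ)ˣ := hol V (p - e τ) (plaqWord κ μ) with hPt
      set Λ1 : (Matrix n n ℂ)ˣ := hol V (p + e κ) (ladder Q μ) with hΛ1
      set Λ2 : (Matrix n n ℂ)ˣ := hol V (p + e κ - e τ) (ladder Q μ) with hΛ2
      set Pl : (Matrix n n ℂ)ˣ := hol V (p - e τ) (plaqWord τ κ) with hPl
      have hSu : S ∈ unitaryUnits (Matrix n n ℂ) := hV _ _
      have hStu : St ∈ unitaryUnits (Matrix n n ℂ) := hV _ _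
      have hUu : U ∈ unitaryUnits (Matrix n n ℂ) := hV _ _
      have hPu : P ∈ unitaryUnits (Matrix n n ℂ) := hol_mem_of (S := unitaryUnits (Matrix n n ℂ)) hV _ _
      have hPlu : Pl ∈ unitaryUnits (Matrix n n ℂ) := hol_mem_of (S := unitaryUnits (Matrix n n ℂ)) hV _ _
      have hΛ2u : Λ2 ∈ unitaryUnits (Matrix n n ℂ) := hol_mem_of (S := unitaryUnits (Matrix n n ℂ)) hV _ _
      -- the induction hypothesis at the base point `p + e_κ`
      obtain ⟨ih1, ih2⟩ := ladder_covShift_le hV μ τ hx0 hplaq hgrad Q hQ' (p + e κ)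
      rw [← hΛ1] at ih1 ih2
      rw [show V (p + e κ - e τ) τ = U' from rfl, ← hΛ2] at ih2
      obtain ⟨ih1t, -⟩ := ladder_covShift_le hV μ τ hx0 hplaq hgrad Q hQ' (p + e κ - e τ)
      rw [← hΛ2] at ih1t
      -- the recursion at `p` and at `p − e_μ`
      have hrec : hol V p (ladder ((κ, true) :: Q) μ) = S * Λ1 * S⁻¹ * P := by
        rw [hol_ladder_cons, stepHol_true, Letter.vec_true, lplaqWord_true]
      have hrect : hol V (p - e τ) (ladder ((κ, true) :: Q) μ) = St * Λ2 * St⁻¹ * Pt := by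
        rw [hol_ladder_cons, stepHol_true, Letter.vec_true, lplaqWord_true, show p - e τ + e κ = p + e κ - e τ by abel]
      -- the plaquette `(τ, κ)` at `p − e_τ`: `U·S = Pl·S̃·U′`
      have hPleq : Pl = U * S * U'⁻¹ * St⁻¹ := by
        rw [hPl, hol_plaqWord_eq, sub_add_cancel, show p - e τ + e κ = p + e κ - e τ by abel]
      have hUS : U * S = Pl * St * U' := by rw [hPleq]; group
      -- sizes
      have hxS : ‖(Pl : Matrix n n ℂ) - 1‖ ≤ x := hplaq (p - e τ) τ κ (Ne.symm hκτ)
      have hxP : ‖(P : Matrix n n ℂ) - 1‖ ≤ x := hplaq p κ μ hκμ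
      have hgr : ‖Ad U (P : Matrix n n ℂ) - (Pt : Matrix n n ℂ)‖ ≤ x₁ := by
        have h := hgrad (p - e τ) κ hκμ
        rwa [sub_add_cancel] at h
      have hlen : (((κ, true) :: Q).length : ℝ) = Q.length + 1 := by push_cast [List.length_cons]; ring
      constructor
      · -- `‖Λ − 1‖ ≤ (|Q|+1)·x`
        rw [hrec, Units.val_mul]
        have h1 : ‖((S * Λ1 * S⁻¹ : (Matrix n n ℂ)ˣ) : Matrix n n ℂ) - 1‖ ≤ ‖(Λ1 : Matrix n n ℂ) - 1‖ := by
          rw [Units.val_mul, Units.val_mul]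
          exact norm_units_conj_sub_one_le (mem_U1_of_unitary hSu) _
        have hAB : ∀ (A B : Matrix n n ℂ), ‖B‖ ≤ 1 → ‖A * B - 1‖ ≤ ‖A - 1‖ + ‖B - 1‖ := by
          intro A B hB
          have h : A * B - 1 = (A - 1) * B + (B - 1) := by noncomm_ring
          rw [h]
          calc ‖(A - 1) * B + (B - 1)‖ ≤ ‖(A - 1) * B‖ + ‖B - 1‖ := norm_add_le _ _
            _ ≤ ‖A - 1‖ * ‖B‖ + ‖B - 1‖ := by gcongr; exact norm_mul_le _ _
            _ ≤ ‖A - 1‖ * 1 + ‖B - 1‖ := by gcongr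
            _ = ‖A - 1‖ + ‖B - 1‖ := by ring
        calc ‖((S * Λ1 * S⁻¹ : (Matrix n n ℂ)ˣ) : Matrix n n ℂ) * (P : Matrix n n ℂ) - 1‖ ≤ ‖((S * Λ1 * S⁻¹ : (Matrix n n ℂ)ˣ) : Matrix n n ℂ) - 1‖ + ‖(P : Matrix n n ℂ) - 1‖ :=
              hAB _ _ (norm_coe_eq_one hPu).le
          _ ≤ Q.length * x + x := add_le_add (h1.trans ih1) hxP
          _ = ((κ, true) :: Q).length * x := by rw [hlen]; ring
      · -- the covariant difference
        have hkey : Ad U ((hol V p (ladder ((κ, true) :: Q) μ) : (Matrix n n ℂ)ˣ) : Matrix n n ℂ) - ((hol V (p - e τ) (ladder ((κ, true) :: Q) μ) : (Matrix n n ℂ)ˣ) : Matrix n n ℂ)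
            = (Ad Pl (Ad St (Λ2 : Matrix n n ℂ)) - Ad St (Λ2 : Matrix n n ℂ)) * Ad U (P : Matrix n n ℂ)
              + Ad (Pl * St) (Ad U' (Λ1 : Matrix n n ℂ) - (Λ2 : Matrix n n ℂ)) * Ad U (P : Matrix n n ℂ)
              + Ad St (Λ2 : Matrix n n ℂ) * (Ad U (P : Matrix n n ℂ) - (Pt : Matrix n n ℂ)) := by
          rw [hrec, hrect]
          -- `Ad U (S Λ1 S⁻¹ P) = Ad (U S) Λ1 · Ad U P` and `U S = Pl St U'`
          have hAdU : ∀ (A Y : (Matrix n n ℂ)ˣ), Ad A (Y : Matrix n n ℂ) = ((A * Y * A⁻¹ : (Matrix n n ℂ)ˣ) : Matrix n n ℂ) := fun A Y => by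
            unfold Ad; simp only [Units.val_mul]
          have e1 : Ad U (((S * Λ1 * S⁻¹ * P : (Matrix n n ℂ)ˣ) : Matrix n n ℂ)) = Ad (Pl * St) (Ad U' (Λ1 : Matrix n n ℂ)) * Ad U (P : Matrix n n ℂ) := by
            rw [hAdU, hAdU, hAdU, hAdU, ← Units.val_mul]
            congr 1
            rw [hPleq]
            group
          have e2 : (((St * Λ2 * St⁻¹ * Pt : (Matrix n n ℂ)ˣ) : Matrix n n ℂ)) = Ad St (Λ2 : Matrix n n ℂ) * (Pt : Matrix n n ℂ) := by
            unfold Ad; simp only [Units.val_mul]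
          rw [e1, e2]
          simp only [Ad_mul, Ad_sub]
          noncomm_ring
        rw [hkey]
        have hY1 : ‖Ad St (Λ2 : Matrix n n ℂ) - 1‖ ≤ Q.length * x := by
          have : ‖Ad St (Λ2 : Matrix n n ℂ) - 1‖ ≤ ‖(Λ2 : Matrix n n ℂ) - 1‖ := by
            unfold Ad; exact norm_units_conj_sub_one_le (mem_U1_of_unitary hStu) _
          exact this.trans ih1t
        have hY : ‖Ad St (Λ2 : Matrix n n ℂ)‖ = 1 := by rw [norm_Ad_of_unitary hStu, norm_coe_eq_one hΛ2u]
        have hUP : ‖Ad U (P : Matrix n n ℂ)‖ = 1 := by rw [norm_Ad_of_unitary hUu, norm_coe_eq_one hPu]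
        have hPlStu : Pl * St ∈ unitaryUnits (Matrix n n ℂ) := (unitaryUnits (Matrix n n ℂ)).mul_mem hPlu hStu
        have t1 : ‖(Ad Pl (Ad St (Λ2 : Matrix n n ℂ)) - Ad St (Λ2 : Matrix n n ℂ)) * Ad U (P : Matrix n n ℂ)‖ ≤ 2 * x * (Q.length * x) := by
          calc _ ≤ ‖Ad Pl (Ad St (Λ2 : Matrix n n ℂ)) - Ad St (Λ2 : Matrix n n ℂ)‖ * ‖Ad U (P : Matrix n n ℂ)‖ := norm_mul_le _ _
            _ ≤ (2 * ‖(Pl : Matrix n n ℂ) - 1‖ * ‖Ad St (Λ2 : Matrix n n ℂ) - 1‖) * 1 := by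
                rw [hUP]; exact mul_le_mul_of_nonneg_right (norm_Ad_sub_le_of_sub_one hPlu _) zero_le_one
            _ ≤ 2 * x * (Q.length * x) := by
                rw [mul_one]; gcongr
        have t2 : ‖Ad (Pl * St) (Ad U' (Λ1 : Matrix n n ℂ) - (Λ2 : Matrix n n ℂ)) * Ad U (P : Matrix n n ℂ)‖ ≤ Q.length * x₁ + 2 * (Q.length : ℝ) ^ 2 * x ^ 2 := by
          calc _ ≤ ‖Ad (Pl * St) (Ad U' (Λ1 : Matrix n n ℂ) - (Λ2 : Matrix n n ℂ))‖ * ‖Ad U (P : Matrix n n ℂ)‖ := norm_mul_le _ _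
            _ = ‖Ad U' (Λ1 : Matrix n n ℂ) - (Λ2 : Matrix n n ℂ)‖ := by rw [hUP, mul_one, norm_Ad_of_unitary hPlStu]
            _ ≤ _ := ih2
        have t3 : ‖Ad St (Λ2 : Matrix n n ℂ) * (Ad U (P : Matrix n n ℂ) - (Pt : Matrix n n ℂ))‖ ≤ x₁ := by
          calc _ ≤ ‖Ad St (Λ2 : Matrix n n ℂ)‖ * ‖Ad U (P : Matrix n n ℂ) - (Pt : Matrix n n ℂ)‖ := norm_mul_le _ _
            _ ≤ 1 * x₁ := by rw [hY]; exact mul_le_mul_of_nonneg_left hgr zero_le_one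
            _ = x₁ := one_mul _
        calc _ ≤ ‖(Ad Pl (Ad St (Λ2 : Matrix n n ℂ)) - Ad St (Λ2 : Matrix n n ℂ)) * Ad U (P : Matrix n n ℂ) + Ad (Pl * St) (Ad U' (Λ1 : Matrix n n ℂ) - (Λ2 : Matrix n n ℂ)) * Ad U (P : Matrix n n ℂ)‖
              + ‖Ad St (Λ2 : Matrix n n ℂ) * (Ad U (P : Matrix n n ℂ) - (Pt : Matrix n n ℂ))‖ := norm_add_le _ _
          _ ≤ (2 * x * (Q.length * x) + (Q.length * x₁ + 2 * (Q.length : ℝ) ^ 2 * x ^ 2)) + x₁ :=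
              add_le_add ((norm_add_le _ _).trans (add_le_add t1 t2)) t3
          _ ≤ ((κ, true) :: Q).length * x₁ + 2 * (((κ, true) :: Q).length : ℝ) ^ 2 * x ^ 2 := by
              rw [hlen]
              nlinarith [mul_nonneg (Nat.cast_nonneg Q.length) (sq_nonneg x), sq_nonneg x, hx10]


/-! ## §2 A common prefix of the ladder word does not change the norm of a difference -/

/-- **PREFIX PEELING**: `‖V(p; ladder_{A++X} μ) − V(p; ladder_{A++Y} μ)‖ ≤ ‖V(p + disp A; ladder_X μ) − V(p + disp A; ladder_Y μ)‖` for ANY word `A` (each letter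
of `A` conjugates both tails by the same unitary transporter and multiplies both by the same unitary plaquette variable, `hol_ladder_cons`). [folklore] -/
theorem norm_ladder_append_sub_le [Nonempty n] {V : Site d → Fin d → (Matrix n n ℂ)ˣ} (hV : IsUnitaryCfg V) (μ : Fin d) :
    ∀ (A X Y : List (Letter d)) (p : Site d),
      ‖((hol V p (ladder (A ++ X) μ) : (Matrix n n ℂ)ˣ) : Matrix n n ℂ) - ((hol V p (ladder (A ++ Y) μ) : (Matrix n n ℂ)ˣ) : Matrix n n ℂ)‖
        ≤ ‖((hol V (p + disp A) (ladder X μ) : (Matrix n n ℂ)ˣ) : Matrix n n ℂ) - ((hol V (p + disp A) (ladder Y μ) : (Matrix n n ℂ)ˣ) : Matrix n n ℂ)‖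
  | [], X, Y, p => by simp
  | l :: A, X, Y, p => by
      rw [List.cons_append, List.cons_append, hol_ladder_cons, hol_ladder_cons, disp_cons, ← add_assoc]
      set S : (Matrix n n ℂ)ˣ := stepHol V p l with hS
      set P : (Matrix n n ℂ)ˣ := hol V p (lplaqWord l μ) with hP
      set Λ1 : (Matrix n n ℂ)ˣ := hol V (p + l.vec) (ladder (A ++ X) μ) with hΛ1
      set Λ2 : (Matrix n n ℂ)ˣ := hol V (p + l.vec) (ladder (A ++ Y) μ) with hΛ2
      have hU : ∀ x κ, V x κ ∈ U1 (Matrix n n ℂ) := fun x κ => mem_U1_of_unitary (hV x κ)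
      have hSu : S ∈ unitaryUnits (Matrix n n ℂ) := by
        obtain ⟨κ, b⟩ := l
        cases b
        · simp only [hS, stepHol_false]; exact (unitaryUnits (Matrix n n ℂ)).inv_mem (hV _ _)
        · simp only [hS, stepHol_true]; exact hV _ _
      have hPu : P ∈ unitaryUnits (Matrix n n ℂ) := hol_mem_of (S := unitaryUnits (Matrix n n ℂ)) hV _ _
      have hkey : (((S * Λ1 * S⁻¹ * P : (Matrix n n ℂ)ˣ)) : Matrix n n ℂ) - (((S * Λ2 * S⁻¹ * P : (Matrix n n ℂ)ˣ)) : Matrix n n ℂ)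
          = Ad S ((Λ1 : Matrix n n ℂ) - (Λ2 : Matrix n n ℂ)) * (P : Matrix n n ℂ) := by
        simp only [Units.val_mul, Ad, mul_sub, sub_mul]
      rw [hkey]
      calc ‖Ad S ((Λ1 : Matrix n n ℂ) - (Λ2 : Matrix n n ℂ)) * (P : Matrix n n ℂ)‖
          ≤ ‖Ad S ((Λ1 : Matrix n n ℂ) - (Λ2 : Matrix n n ℂ))‖ * ‖(P : Matrix n n ℂ)‖ := norm_mul_le _ _
        _ = ‖(Λ1 : Matrix n n ℂ) - (Λ2 : Matrix n n ℂ)‖ := by rw [norm_Ad_of_unitary hSu, norm_coe_eq_one hPu, mul_one]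
        _ ≤ _ := norm_ladder_append_sub_le hV μ A X Y (p + l.vec)

/-! ## §3 Inserting one forward letter into the ladder word -/

/-- **ONE MORE LETTER IN FRONT**: for `τ ≠ μ` and a forward word `B` avoiding `μ` and `τ`,
`‖V(q; ladder_{(τ,+)::B} μ) − V(q; ladder_B μ)‖ ≤ |B|·x₁ + 2|B|²·x² + x` — the new ladder is `Ad_{V(q,τ)}V(q + e_τ; ladder_B μ)` times the plaquette
`V(∂p(q; τ, μ))` (`hol_ladder_cons`), so the difference is the covariant `τ`-shift of §1 plus one plaquette. [folklore] -/
theorem norm_ladder_cons_sub_le [Nonempty n] {V : Site d → Fin d → (Matrix n n ℂ)ˣ} (hV : IsUnitaryCfg V) {μ τ : Fin d} (hτμ : τ ≠ μ) {x x₁ : ℝ}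
    (hx0 : 0 ≤ x) (hplaq : SmallField V x)
    (hgrad : ∀ (p : Site d) (κ : Fin d), κ ≠ μ →
      ‖Ad (V p τ) ((hol V (p + e τ) (plaqWord κ μ) : (Matrix n n ℂ)ˣ) : Matrix n n ℂ) - ((hol V p (plaqWord κ μ) : (Matrix n n ℂ)ˣ) : Matrix n n ℂ)‖ ≤ x₁)
    {B : List (Letter d)} (hB : ∀ l ∈ B, l.2 = true ∧ l.1 ≠ μ ∧ l.1 ≠ τ) (q : Site d) :
    ‖((hol V q (ladder ((τ, true) :: B) μ) : (Matrix n n ℂ)ˣ) : Matrix n n ℂ) - ((hol V q (ladder B μ) : (Matrix n n ℂ)ˣ) : Matrix n n ℂ)‖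
      ≤ B.length * x₁ + 2 * (B.length : ℝ) ^ 2 * x ^ 2 + x := by
  rw [hol_ladder_cons, stepHol_true, Letter.vec_true, lplaqWord_true]
  set S : (Matrix n n ℂ)ˣ := V q τ with hS
  set P : (Matrix n n ℂ)ˣ := hol V q (plaqWord τ μ) with hP
  set Λ1 : (Matrix n n ℂ)ˣ := hol V (q + e τ) (ladder B μ) with hΛ1
  set Λ0 : (Matrix n n ℂ)ˣ := hol V q (ladder B μ) with hΛ0
  have hSu : S ∈ unitaryUnits (Matrix n n ℂ) := hV _ _
  have hPu : P ∈ unitaryUnits (Matrix n n ℂ) := hol_mem_of (S := unitaryUnits (Matrix n n ℂ)) hV _ _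
  have hΛ0u : Λ0 ∈ unitaryUnits (Matrix n n ℂ) := hol_mem_of (S := unitaryUnits (Matrix n n ℂ)) hV _ _
  have hxP : ‖(P : Matrix n n ℂ) - 1‖ ≤ x := hplaq q τ μ hτμ
  -- the covariant `τ`-shift of §1 at the base point `q + e_τ`
  have hshift : ‖Ad S (Λ1 : Matrix n n ℂ) - (Λ0 : Matrix n n ℂ)‖ ≤ B.length * x₁ + 2 * (B.length : ℝ) ^ 2 * x ^ 2 := by
    have h := (ladder_covShift_le hV μ τ hx0 hplaq hgrad B hB (q + e τ)).2
    rwa [add_sub_cancel_right] at h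
  have hkey : (((S * Λ1 * S⁻¹ * P : (Matrix n n ℂ)ˣ)) : Matrix n n ℂ) - (Λ0 : Matrix n n ℂ)
      = (Ad S (Λ1 : Matrix n n ℂ) - (Λ0 : Matrix n n ℂ)) * (P : Matrix n n ℂ) + (Λ0 : Matrix n n ℂ) * ((P : Matrix n n ℂ) - 1) := by
    simp only [Units.val_mul, Ad]
    noncomm_ring
  rw [hkey]
  calc ‖(Ad S (Λ1 : Matrix n n ℂ) - (Λ0 : Matrix n n ℂ)) * (P : Matrix n n ℂ) + (Λ0 : Matrix n n ℂ) * ((P : Matrix n n ℂ) - 1)‖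
      ≤ ‖(Ad S (Λ1 : Matrix n n ℂ) - (Λ0 : Matrix n n ℂ)) * (P : Matrix n n ℂ)‖ + ‖(Λ0 : Matrix n n ℂ) * ((P : Matrix n n ℂ) - 1)‖ := norm_add_le _ _
    _ ≤ ‖Ad S (Λ1 : Matrix n n ℂ) - (Λ0 : Matrix n n ℂ)‖ * ‖(P : Matrix n n ℂ)‖ + ‖(Λ0 : Matrix n n ℂ)‖ * ‖(P : Matrix n n ℂ) - 1‖ :=
        add_le_add (norm_mul_le _ _) (norm_mul_le _ _)
    _ ≤ (B.length * x₁ + 2 * (B.length : ℝ) ^ 2 * x ^ 2) * 1 + 1 * x := by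
        rw [norm_coe_eq_one hPu, norm_coe_eq_one hΛ0u]
        exact add_le_add (mul_le_mul_of_nonneg_right hshift zero_le_one) (mul_le_mul_of_nonneg_left hxP zero_le_one)
    _ = B.length * x₁ + 2 * (B.length : ℝ) ^ 2 * x ^ 2 + x := by ring

/-- **INSERTING ONE FORWARD LETTER BEHIND A COMMON PREFIX**: `‖V(p; ladder_{A ++ (τ,+)::B} μ) − V(p; ladder_{A++B} μ)‖ ≤ |B|·x₁ + 2|B|²·x² + x` (§2 then §3 at
`q = p + disp A`). [folklore] -/
theorem norm_ladder_insert_sub_le [Nonempty n] {V : Site d → Fin d → (Matrix n n ℂ)ˣ} (hV : IsUnitaryCfg V) {μ τ : Fin d} (hτμ : τ ≠ μ) {x x₁ : ℝ}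
    (hx0 : 0 ≤ x) (hplaq : SmallField V x)
    (hgrad : ∀ (p : Site d) (κ : Fin d), κ ≠ μ →
      ‖Ad (V p τ) ((hol V (p + e τ) (plaqWord κ μ) : (Matrix n n ℂ)ˣ) : Matrix n n ℂ) - ((hol V p (plaqWord κ μ) : (Matrix n n ℂ)ˣ) : Matrix n n ℂ)‖ ≤ x₁)
    (A : List (Letter d)) {B : List (Letter d)} (hB : ∀ l ∈ B, l.2 = true ∧ l.1 ≠ μ ∧ l.1 ≠ τ) (p : Site d) :
    ‖((hol V p (ladder (A ++ (τ, true) :: B) μ) : (Matrix n n ℂ)ˣ) : Matrix n n ℂ) - ((hol V p (ladder (A ++ B) μ) : (Matrix n n ℂ)ˣ) : Matrix n n ℂ)‖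
      ≤ B.length * x₁ + 2 * (B.length : ℝ) ^ 2 * x ^ 2 + x :=
  (norm_ladder_append_sub_le hV μ A ((τ, true) :: B) B p).trans (norm_ladder_cons_sub_le hV hτμ hx0 hplaq hgrad hB _)


end

end Summit.QuantumFields.BalabanUV.T4Continuum.NE7LadderCovariantShift
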